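import Summits.AtomisticToContinuum.Crystallization.Theorems.OverbindingBudgetStackedRigidityRef

/-!
# OverbindingBudget · decomp-a2c lens-4 g31 — part XIX-U: the CONVEX-READY INTERFACE for slot 7c (critic row 458, R4 pivot of record)

Helper file under `--supports stmt-AtomisticToContinuum-31280` (RDEF = `Theses.OverbindingBudget.RobustDefectLimitWindows`).  Nothing here
closes RDEF.

Row 458 replaced the scalar tube data of slot 7c′ by E1′/W′: W′ = `TubeConvexW Λ₁ ρ₀` (global `ℓ²`-monotonicity of the profile-force map on
finitely supported differences along the thin tube — energy convexity, CERT by normal-block dominance + tangential positivity) and the GLUE E1′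
`incr_eq_of_tubeConvex` (discrete Liouville for bounded `ℓ²`-monotone differences), both lens-3 g24's TASK 1.  What the slot-7 seam actually
CONSUMES from any such data is one sentence — *inside the thin tube round an admissible zero-gap-stress configuration the zero-gap-stress
increment profile is unique* — and this file types exactly that sentence as the interface, so that the scalar data (landed, part XIX) and the
convex data (lens-3 g24, to land) feed the SAME cone by name, with no definition shared between the two seats:

* 7c♭ `TubeUniquenessW Λ₁ ρ` — for every admissible configuration `w` (`δ`-separated, clean-W, single-site Nash, stacked over independent periods
  of norm `≤ Λ₁`, stress-free, zero transmitted stress across every gap) and every stacked profile `w′` over the same periods whose increments lie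
  in `tube w ρ` and whose gap stresses vanish, `incr w′ = incr w`.  [UNDECIDED · TRUE-type for `ρ ≤` the convexity radius of the gap energy
  round the registry (`0.05–0.07` by lens-3's tangential/normal block margins; `≥ ρ⋆_scalar ≈ 0.02–0.03` in any case) · ANALYTIC (E1′) + CERT (W′)]
* FEEDERS: `tubeUniquenessW_of_tubeW' : TubeMonotoneW' Λ₁ ρ → TubeUniquenessW Λ₁ ρ` (PROVED, part XVIII's kernel `eq_of_equal_stress`);
  the convex feeder `TubeConvexW Λ₁ ρ → TubeUniquenessW Λ₁ ρ` is lens-3 g24's E1′ glue, to be landed against THIS name.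
* SEAM `basalGapRigidityW_of_uniq : TubeUniquenessW Λ₁ ρ → BasalReferenceW Λ₁ ρ → BasalGapRigidityW Λ₁` (PROVED: the reference is then a
  translate) and ★ the SIXTEENTH cone in interface form `rdef_of_grossU_shape_gluing_pinning_uniqW Λ Λ₁ ρ₀ ρ₁` (slot 7c/7d := 7c″
  `RegistryPinningW Λ₁ ρ₀ ρ₁` ∧ 7c♭ `TubeUniquenessW Λ₁ ρ₀` ∧ 7d `BasalReferenceW Λ₁ ρ₁`); composing with lens-3's feeder gives the critic's
  `rdef_of_grossU_shape_gluing_pinning_convexW` in one line.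
* The reference-centred twin: `TubeUniquenessRef Λ₁ ρ` (uniqueness in the tube round a zero-gap-stress uniformly clean clean-W REFERENCE), feeder
  `tubeUniquenessRef_of_tubeRef : TubeMonotoneRef Λ₁ ρ → TubeUniquenessRef Λ₁ ρ` (PROVED), seam `basalGapRigidityW_of_uniqRef`, cone
  `rdef_of_grossU_shape_gluing_pinning_uniqRef Λ Λ₁ ρ₀ ρ₁`.
-/

noncomputable section

namespace Summit.AtomisticToContinuum.Crystallization.Theorems.OverbindingBudgetStackedRigidityUniq

open Metric
open scoped RealInnerProductSpace
open Summit.AtomisticToContinuum.Crystallization.Theses.OverbindingBudget (RobustDefectLimitWindows)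
open Summit.AtomisticToContinuum.Crystallization.Theses.PricedLinkCensus (ChargedEnergyGap)
open Summit.AtomisticToContinuum.Crystallization.Theorems.OverbindingBudgetGradedBareness (CleanlessExcessT)
open Summit.AtomisticToContinuum.Crystallization.Theorems.OverbindingBudgetCoherentCut (CoherentResidual)
open Summit.AtomisticToContinuum.Crystallization.Theorems.OverbindingBudgetUniformCutStatements (GrossCleanBallsU)
open Summit.AtomisticToContinuum.Crystallization.Theorems.OverbindingBudgetElasticSplitScale (CompressedVirialLaw)
open Summit.AtomisticToContinuum.Crystallization.Theorems.OverbindingBudgetElasticSplitShear (StressFree)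
open Summit.AtomisticToContinuum.Crystallization.Theorems.ChartedPlanarOrderChunkFloor (E3)
open Summit.AtomisticToContinuum.Crystallization.Theorems.ChartedPlanarOrderRigidityDoor (IsNash)
open Summit.AtomisticToContinuum.Crystallization.Theorems.ChartedPlanarOrderDensityDichotomy (μS IsSep)
open Summit.AtomisticToContinuum.Crystallization.Theorems.ChartedPlanarOrderDoorLayered (Layered)
open Summit.AtomisticToContinuum.Crystallization.Theorems.ChartedPlanarOrderProfileSlavingLJ (IsStacked gapStress incr tube
  translation_iff_incr_eq)
open Summit.AtomisticToContinuum.Crystallization.Theorems.ChartedPlanarOrderTubeMonotoneSplit (eta_nonneg incr_mem_tube norm_sub_le_two_eta)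
open Summit.AtomisticToContinuum.Crystallization.Theorems.OverbindingBudgetPeriodicCleanOrStrained (UniformlyClean)
open Summit.AtomisticToContinuum.Crystallization.Theorems.OverbindingBudgetScaleWidening (IsCleanW DoorPeriodicW)
open Summit.AtomisticToContinuum.Crystallization.Theorems.OverbindingBudgetTwoShellShape (TwoShellShape BarlowGluingW)
open Summit.AtomisticToContinuum.Crystallization.Theorems.OverbindingBudgetStackedRigidityW (StackedReductionW GapStressVanishesW
  BasalGapRigidityW BasalReferenceW eq_of_equal_stress uniformlyClean_translate layered_add_const rdef_of_grossU_shape_gluing_stackedW)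
open Summit.AtomisticToContinuum.Crystallization.Theorems.OverbindingBudgetStackedRigidityRef (TubeMonotoneW' RegistryPinningW
  basalReferenceW_of_pinning TubeMonotoneRef BasalReferenceCW basalReferenceCW_of_pinning isSep_of_uniformlyClean incr_mem_tube_symm)

/-! ## The interface: uniqueness of the zero-gap-stress profile in the thin tube -/

/-- **7c♭ · `TubeUniquenessW Λ₁ ρ`** — inside the `ρ`-tube round an admissible zero-gap-stress configuration (`δ`-separated, clean-W, single-site
Nash, stacked over independent periods of norm `≤ Λ₁`, stress-free, zero transmitted stress across every gap), a stacked profile over the same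
periods with zero gap stresses has the SAME increments.  The conclusion of either 7c′-data: scalar (`tubeUniquenessW_of_tubeW'`, PROVED) or
convex (lens-3 g24's E1′ glue `TubeConvexW Λ₁ ρ → TubeUniquenessW Λ₁ ρ`).  Why it might fail: only beyond the convexity radius of the gap energy
round the registry (`ρ ≳ 0.07`). [ANALYTIC (E1′) + CERT (W′)] [piece] -/
def TubeUniquenessW (Λ₁ ρ : ℝ) : Prop :=
  ∀ δ : ℝ, 0 < δ → ∀ (a b : E3) (w : ℤ → E3), IsStacked a b w → LinearIndependent ℝ ![a, b] →
    ‖a‖ ≤ Λ₁ → ‖b‖ ≤ Λ₁ → IsSep δ (Layered a b w) → IsCleanW (μS (Layered a b w)) → IsNash (μS (Layered a b w)) →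
    StressFree (Layered a b w) → (∀ m : ℤ, gapStress a b m (incr w) = 0) →
    ∀ w' : ℤ → E3, IsStacked a b w' → (∀ m : ℤ, incr w' m ∈ tube w ρ m) → (∀ m : ℤ, gapStress a b m (incr w') = 0) → incr w' = incr w

/-- **Scalar feeder, PROVED.** `TubeMonotoneW' Λ₁ ρ → TubeUniquenessW Λ₁ ρ` (part XVIII's kernel `eq_of_equal_stress` on the windows `tube w ρ`). [this file] -/
theorem tubeUniquenessW_of_tubeW' {Λ₁ ρ : ℝ} (hT : TubeMonotoneW' Λ₁ ρ) : TubeUniquenessW Λ₁ ρ := by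
  intro δ hδ a b w hst hab ha hb hsep hcl hna hsf hzero w' _hst' htube hzero'
  obtain ⟨lam, κ, hκ0, hκs, _hκ1, hdom, hmono, hlip⟩ := hT δ hδ a b w ha hb hsep hcl hna hst hsf hzero
  have hρ : 0 ≤ ρ := eta_nonneg htube
  have hh : ∀ k, incr w k ∈ tube w ρ k := fun k => incr_mem_tube hρ k
  exact eq_of_equal_stress hκ0 hκs hdom hmono hlip htube hh (fun k => norm_sub_le_two_eta htube hh k)
    (fun m => by rw [hzero m, hzero' m])

/-- **Seam, PROVED.** `TubeUniquenessW Λ₁ ρ → BasalReferenceW Λ₁ ρ → BasalGapRigidityW Λ₁`: the uniformly clean reference in the tube has the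
configuration's increments, so the configuration is a translate of it. [this file] -/
theorem basalGapRigidityW_of_uniq {Λ₁ ρ : ℝ} (hU : TubeUniquenessW Λ₁ ρ) (hR : BasalReferenceW Λ₁ ρ) : BasalGapRigidityW Λ₁ := by
  intro δ hδ a b w hst hab ha hb hsep hcl hna hsf hzero
  obtain ⟨w', hst', htube, hzero', hUC⟩ := hR δ hδ a b w hst hab ha hb hsep hcl hna hsf hzero
  have hincr : incr w' = incr w := hU δ hδ a b w hst hab ha hb hsep hcl hna hsf hzero w' hst' htube hzero'
  obtain ⟨c, hc⟩ := (translation_iff_incr_eq w' w).mpr fun m => by rw [hincr]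
  have hw : w = fun m => w' m + c := funext hc
  rw [hw, layered_add_const]
  exact uniformlyClean_translate (-c) hUC

/-- ★ **RDEF cone, SIXTEENTH form in interface form** (every `Λ`, `Λ₁`, `ρ₀`, `ρ₁`; of record at `(2, 17/16; 1/40, 3/16)`): the fifteenth with
slot 7c/7d := 7c″ `RegistryPinningW Λ₁ ρ₀ ρ₁` ∧ 7c♭ `TubeUniquenessW Λ₁ ρ₀` ∧ 7d `BasalReferenceW Λ₁ ρ₁`.  With lens-3's E1′ glue
`TubeConvexW Λ₁ ρ₀ → TubeUniquenessW Λ₁ ρ₀` this is the critic's `rdef_of_grossU_shape_gluing_pinning_convexW` in one line; with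
`tubeUniquenessW_of_tubeW'` it is part XIX's scalar sixteenth. [this file] -/
theorem rdef_of_grossU_shape_gluing_pinning_uniqW (Λ Λ₁ ρ₀ ρ₁ : ℝ) (hG : GrossCleanBallsU (1 / 250) 10) (hCEG : ChargedEnergyGap)
    (hC : CompressedVirialLaw (1 / 250) 10) (hS : TwoShellShape (1 / 100) (3 / 50) (1 / 450)) (hB₂ : BarlowGluingW) (hD : DoorPeriodicW Λ)
    (hSR : StackedReductionW Λ Λ₁) (hV : GapStressVanishesW Λ₁) (hP : RegistryPinningW Λ₁ ρ₀ ρ₁) (hU : TubeUniquenessW Λ₁ ρ₀)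
    (hRef : BasalReferenceW Λ₁ ρ₁) (hCE : CleanlessExcessT) (hRes : CoherentResidual 10) : RobustDefectLimitWindows :=
  rdef_of_grossU_shape_gluing_stackedW Λ Λ₁ hG hCEG hC hS hB₂ hD hSR hV
    (basalGapRigidityW_of_uniq hU (basalReferenceW_of_pinning hRef hP)) hCE hRes

/-! ## The reference-centred twin of the interface -/

/-- **7c♭‴ · `TubeUniquenessRef Λ₁ ρ`** — inside the `ρ`-tube round a REFERENCE (`δ`-separated stacked profile over independent periods of norm
`≤ Λ₁`, clean-W and UNIFORMLY CLEAN layered set, zero gap stress across every gap), a stacked profile over the same periods with zero gap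
stresses has the reference's increments.  Currency-free. Fed by `TubeMonotoneRef` (PROVED below) or by convex data round the reference. [piece] -/
def TubeUniquenessRef (Λ₁ ρ : ℝ) : Prop :=
  ∀ δ : ℝ, 0 < δ → ∀ (a b : E3) (w' : ℤ → E3), IsStacked a b w' → LinearIndependent ℝ ![a, b] → ‖a‖ ≤ Λ₁ → ‖b‖ ≤ Λ₁ →
    IsSep δ (Layered a b w') → IsCleanW (μS (Layered a b w')) → (∀ m : ℤ, gapStress a b m (incr w') = 0) →
    UniformlyClean (Layered a b w') →
    ∀ w : ℤ → E3, IsStacked a b w → (∀ m : ℤ, incr w m ∈ tube w' ρ m) → (∀ m : ℤ, gapStress a b m (incr w) = 0) → incr w = incr w'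

/-- **Scalar feeder, PROVED.** `TubeMonotoneRef Λ₁ ρ → TubeUniquenessRef Λ₁ ρ`. [this file] -/
theorem tubeUniquenessRef_of_tubeRef {Λ₁ ρ : ℝ} (hT : TubeMonotoneRef Λ₁ ρ) : TubeUniquenessRef Λ₁ ρ := by
  intro δ hδ a b w' hst' hab ha hb hsep hcl hzero' hUC w _hst htube hzero
  obtain ⟨lam, κ, hκ0, hκs, _hκ1, hdom, hmono, hlip⟩ := hT δ hδ a b w' hst' hab ha hb hsep hcl hzero' hUC
  have hρ : 0 ≤ ρ := eta_nonneg htube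
  have hh : ∀ k, incr w' k ∈ tube w' ρ k := fun k => incr_mem_tube hρ k
  exact eq_of_equal_stress hκ0 hκs hdom hmono hlip htube hh (fun k => norm_sub_le_two_eta htube hh k)
    (fun m => by rw [hzero m, hzero' m])

/-- **Seam, PROVED.** `TubeUniquenessRef Λ₁ ρ → BasalReferenceCW Λ₁ ρ → BasalGapRigidityW Λ₁`. [this file] -/
theorem basalGapRigidityW_of_uniqRef {Λ₁ ρ : ℝ} (hU : TubeUniquenessRef Λ₁ ρ) (hR : BasalReferenceCW Λ₁ ρ) : BasalGapRigidityW Λ₁ := by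
  intro δ hδ a b w hst hab ha hb hsep hcl hna hsf hzero
  obtain ⟨w', hst', htube, hzero', hUC, hcl'⟩ := hR δ hδ a b w hst hab ha hb hsep hcl hna hsf hzero
  have hincr : incr w = incr w' :=
    hU (9 / 10) (by norm_num) a b w' hst' hab ha hb (isSep_of_uniformlyClean hUC) hcl' hzero' hUC w hst
      (fun m => incr_mem_tube_symm (htube m)) hzero
  obtain ⟨c, hc⟩ := (translation_iff_incr_eq w' w).mpr fun m => by rw [hincr]
  have hw : w = fun m => w' m + c := funext hc
  rw [hw, layered_add_const]
  exact uniformlyClean_translate (-c) hUC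

/-- **RDEF cone, SEVENTEENTH form in interface form**: the fifteenth with slot 7c/7d := 7c″ `RegistryPinningW Λ₁ ρ₀ ρ₁` ∧ 7c♭‴
`TubeUniquenessRef Λ₁ ρ₀` ∧ 7d″ `BasalReferenceCW Λ₁ ρ₁`. [this file] -/
theorem rdef_of_grossU_shape_gluing_pinning_uniqRef (Λ Λ₁ ρ₀ ρ₁ : ℝ) (hG : GrossCleanBallsU (1 / 250) 10) (hCEG : ChargedEnergyGap)
    (hC : CompressedVirialLaw (1 / 250) 10) (hS : TwoShellShape (1 / 100) (3 / 50) (1 / 450)) (hB₂ : BarlowGluingW) (hD : DoorPeriodicW Λ)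
    (hSR : StackedReductionW Λ Λ₁) (hV : GapStressVanishesW Λ₁) (hP : RegistryPinningW Λ₁ ρ₀ ρ₁) (hU : TubeUniquenessRef Λ₁ ρ₀)
    (hRef : BasalReferenceCW Λ₁ ρ₁) (hCE : CleanlessExcessT) (hRes : CoherentResidual 10) : RobustDefectLimitWindows :=
  rdef_of_grossU_shape_gluing_stackedW Λ Λ₁ hG hCEG hC hS hB₂ hD hSR hV
    (basalGapRigidityW_of_uniqRef hU (basalReferenceCW_of_pinning hRef hP)) hCE hRes

end Summit.AtomisticToContinuum.Crystallization.Theorems.OverbindingBudgetStackedRigidityUniq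

end
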